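import Summits.QuantumFields.BalabanUV.Beta.GAN24.ContactBorderPartner
import Summits.QuantumFields.BalabanUV.Beta.GAN24.HessianGaugeLegContact

/-!
# `GAN24.ContactOneGaugeCellLambda` — CT-ROUTE step «CT-3aH»: THE ONE-GAUGE CONTACT CELL OF THE Λ-PIECE `SLam L c (hessFFAt ρ L)` IS
# `⟨W, (−Σ_μ Σ_y c·(ψ at four contact sites)·q¹∕2)·R⟩` AND IS BOUNDED BY «ENVELOPES + COEFFICIENT DECAY IN, `2^{d+1}·ℓ·Zl(δ∕2)·N^{d+1}·Zl·e^{−κ′·spread}` OUT»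
# (the row owner's CALL [GAN24P1-G19-P1] «CT-3aV ∕ CT-3aH»; the H∕Λ half — the pure Hessian table enters the step family ONLY through the Λ-piece)

HONEST FRAMING (cell charter, verbatim): «discharging `BetaPertH` makes Bałaban's UV stability UNCONDITIONAL — a real constructive-QFT result;
it is NOT the continuum limit and NOT the Clay problem.»  DERIVED cell leaf (pub-balaban, G-an2-4 formalisation swarm → CRUX TEAM (2), seat
`b2b-balaban-gan24-formalise-leaf-02`, gen 47): [folklore] bookkeeping (a finite box sum of at most `2^{d+1}` coarse bonds, two `ℓ¹` triangle inequalities, one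
block-label wobble absorbed by HALF the coefficient rate, one free lattice sum `Zl(δ∕2)`, leaf-12∕g46's free block sum) over `GAN24.HessianGaugeLegContact`
(`tsum_dz_mul_SLam_hessFFAt`), `GAN24.ContactBorderPartner` (near-box ∕ proximity ∕ weight letters), an1's `linKerAt_eq_zero` ∕ `abs_linKerAt_le` and `EnvelopeBlockSum`
∕ `ExpKernelCalculus.tsum_exp_shift` BY NAME; NO cited fact, NO `def`, NO `def … : Prop`, NO wall binder; constants symbolic; the coefficient family `c` is ARBITRARY under a
displayed decay letter (the shape `BalabanStepJetsSucc.abs_lamCoeffK_le` delivers for Bałaban's `lamCoeffK`).  Discharges NO letter of (CONV-C); NEVER «G-an2-4 closed»;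
NOT hS0, NOT D1, NOT `BetaPertH`, NOT continuum, NOT Clay.  «not in print; our bookkeeping».
HONEST DEPENDENCY (cell records, verbatim): «continuum YM on T⁴ ⇐ BetaPertH ∧ nine spine estimates (0/9 proved); BetaPertH ⇐ (D1) ∧ (D4) ∧ CAP+tail;
G-an2-4 gates asym, D1 and NE2/3/4.»
ABSOLUTE RULE (cell charter, verbatim): «No internally-minted statement may enter as a cited fact. Every hypothesis is either kernel-proved in this
package or a verbatim quotation of a PUBLISHED theorem with page reference. The manuscript(s) under audit are NOT citable for their own disputed steps —
they are the thing under adjudication; programme-internal (2001/route/tribunal) claims are never citable.»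

THE OBJECTS (generic `d`, `ℤ^(d+1)`; the TABLE's blocking `L ≥ 1`, box root `ρ = toSite r`, `r ∈ box (d+1) L`, `ℓ := ell (d+1) L`; the LEGS' envelope blocking `N ≥ 1`,
`E_z(u) := e^{−κ₀‖quo N u − z‖∞}`).  The Λ-PIECE `SΛ κ u := InterLevelTransport.SLam L c (fun μ y => hessFFAt ρ L μ y) κ u` — an ff-valued stencil family (so its
INDEX-slot law is an2∕leaf-10's `divV_SLam_lamCoeffK_E2_eq_zero`: transversal, NO index-slot cell), with a coefficient family under the letter
`|c μ y κ u| ≤ C_c·e^{−δ·|L·y − u|₁}`; legs: the INDEX leg `W κ u` (`≤ E₁·E_{z₁}(u)`), the OTHER fluctuation-slot leg `R α′ x′` (`≤ E₃·E_{z₃}(x′)`), the gauge function `ψ`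
(`≤ Eψ·E_{z₀}`) in the FIRST fluctuation slot (the second slot is the mirror image by `SLam_hessFFAt_antisymm`).
## What is proved
* §1 LETTERS: `near_of_linKerAt_ne_zero`, `l1_root_sub_le_of_mem` (`|L·y + ρ − x′|₁ ≤ (d+1)·2L` on the near-set of `x′`), **`abs_hessWeight_le`**
  (`|ψ x′ + ψ(x′ + e_{α′}) − ψ(L·y + ρ) − ψ(L·y + ρ + L·e_μ)| ≤ 4Eψ·e^{2κ₀(d+1)L}·E_{z₀}(x′)`), **`abs_coeff_le_of_mem`** (`|c μ y κ u| ≤ C_c·e^{2δ(d+1)L}·e^{−δ|x′ − u|₁}` for `y`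
  near `x′`: the coefficient's decay is read FROM THE CELL's second leg site).
* §2 THE CONTACT KERNEL of `GAN24.HessianGaugeLegContact.tsum_dz_mul_SLam_hessFFAt`, `KΛ(κ,u; α′,x′) = −Σ_μ Σ'_y c μ y κ u·(weight·q¹,ρ_{(μ,y)}(α′,x′)∕2)`, IS A FINITE SUM
  AND IS BOUNDED: **`abs_lambdaKernel_le`** `|KΛ| ≤ ((d+1)·2^{d+1}·(C_c·e^{2δ(d+1)L})·(4Eψ·e^{2κ₀(d+1)L})·(ℓ∕2))·E_{z₀}(x′)·e^{−δ|x′ − u|₁}`.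
* §3 THE GENERIC Λ-CELL BOUND **`abs_cell_lambda_le`** (second fluctuation leg OUTER, index leg INNER; any kernel `|K κ u α′ x′| ≤ E_K·E_{z₀}(x′)·e^{−δ|x′−u|₁}`; rates
  `0 < κ₀ ≤ δ∕2` — the index leg's wobble is absorbed by half the coefficient rate):
  `|Σ'_{x′} Σ_{α′} R α′ x′ · Σ'_u Σ_κ W κ u · K κ u α′ x′| ≤ (d+1)²·Zl(δ∕2)·E₁E₃E_K·(N^{d+1}·Zl(κ₀∕(4(d+1)))·e^{−(κ₀∕12)(‖z₁−z₀‖∞+‖z₃−z₀‖∞)})`.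
* §4 THE Λ CELL: **`cellLambda_eq`** `Σ'_{x′} Σ_{α′} R α′ x′ · Σ'_u Σ_κ W κ u · (Σ'_x Σ_α (dz ψ) α x · SΛ κ u x x′ (inl α) (inl α′)) = (… · KΛ …)` (hypothesis-free) and **`abs_cellLambda_le`**.
  READING (for X-gan24p1-g19-2): per cell `N^{d+1}·E₁E₃Eψ·C_c` × `L`-constants — the Wilson cell's count with the Maxwell letters replaced by the bounded partner `ℓ∕2`
  and the coefficient letter `C_c`; nothing about the bornSec unit weights is claimed.
NOT HERE: the sym twin (`symHessFFAt`, `symLinKerAt`: identical script on request); the nesting with the index leg outer (absolute convergence — on request); any assembly.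
Provenance: seat b2b-balaban-gan24-formalise-leaf-02 gen 47 (prover-…-leaf-02-g47-0), 2026-08-21; over the files named above BY NAME.
-/

open Finset
open scoped BigOperators Nat
open Literature.MathematicalPhysics.QuantumFieldTheory.LatticeForm (quo)
open Literature.MathematicalPhysics.QuantumFieldTheory.Balaban1983to89
open Literature.MathematicalPhysics.QuantumFieldTheory.Balaban1983to89.Beta
open AffineAveraging AveragingContours AveragingHessianKernels AveragingContoursRooted AveragingHessianKernelsRooted
open B12Sec2to5 (l1 l1_nonneg)
open B4ContourShift (supNorm supNorm_nonneg)
open ExpKernelCalculus (MKer Zl Zl_nonneg Zl_pos l1_sub_triangle l1_sub_symm summable_exp_shift tsum_exp_shift)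
open OneStepResolventKernel (Fib)
open StepJetData (l1_unitVec)
open InterLevelTransport (SLam)
open AveragingWardStencils (b6UnitVec_eq)
open Summit.QuantumFields.BalabanUV.Beta.GAN24.EnvelopeBlockSum (env_wobble env_le_one summable_env)
open Summit.QuantumFields.BalabanUV.Beta.GAN24.ContactOneGaugeCellBound (tsum_env3_le abs_le_of_env summable_of_env)
open Summit.QuantumFields.BalabanUV.Beta.GAN24.ContactBorderPartner (exists_finset_near_card l1_smul_sub_le_of_mem l1_farEnd_sub_le_of_mem abs_weight_le_of_l1_le)
open Summit.QuantumFields.BalabanUV.Beta.GAN24.HessianGaugeLegContact (tsum_dz_mul_SLam_hessFFAt)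

noncomputable section

namespace Summit.QuantumFields.BalabanUV.Beta.GAN24.ContactOneGaugeCellLambda

variable {d : ℕ}

/-! ## §1 Letters: support of the partner, proximity of the root, the four-site weight, the coefficient read from the second leg site -/

section Letters

variable {N L : ℕ} {κ₀ δ : ℝ} {r : Fin (d + 1) → ℕ}

/-- [folklore] SUPPORT of the rooted first-order kernel (box root): `q¹,ρ_{(μ,y)}(α′, x′) ≠ 0 → Near L y x′` (`linKerAt_eq_zero`). -/
theorem near_of_linKerAt_ne_zero (hr : r ∈ box (d + 1) L) {μ : Fin (d + 1)} {y x' : Fin (d + 1) → ℤ} {α' : Fin (d + 1)}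
    (h : linKerAt (toSite r) L μ y (α', x') ≠ 0) : Near L y x' := by
  by_contra hn
  exact h (linKerAt_eq_zero hr (f := (α', x')) hn)

/-- [folklore] PROXIMITY of the root of a near coarse bond: `|L·y + ρ − x′|₁ ≤ (d+1)·2L` for `y` in the near-set of `x′` and a box root. -/
theorem l1_root_sub_le_of_mem (hr : r ∈ box (d + 1) L) {x y : Fin (d + 1) → ℤ} (hy : ∀ i, x i - 2 * (L : ℤ) < (L : ℤ) * y i ∧ (L : ℤ) * y i ≤ x i) :
    l1 ((L : ℤ) • y + toSite r - x) ≤ ((d : ℝ) + 1) * (2 * (L : ℝ)) := by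
  have hri : ∀ i, (0 : ℤ) ≤ (r i : ℤ) ∧ (r i : ℤ) < L := by
    intro i
    have := Finset.mem_range.1 (Fintype.mem_piFinset.1 hr i)
    omega
  unfold l1
  calc ∑ ν, |((((L : ℤ) • y + toSite r - x) ν : ℤ) : ℝ)| ≤ ∑ _ν : Fin (d + 1), 2 * (L : ℝ) := by
        refine Finset.sum_le_sum fun i _ => ?_
        have h := hy i
        have hr' := hri i
        rw [abs_le]
        simp only [Pi.sub_apply, Pi.add_apply, Pi.smul_apply, smul_eq_mul, toSite]
        push_cast
        have h1 : ((x i : ℤ) : ℝ) - 2 * (L : ℝ) < (L : ℝ) * (y i : ℝ) := by exact_mod_cast h.1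
        have h2 : (L : ℝ) * (y i : ℝ) ≤ ((x i : ℤ) : ℝ) := by exact_mod_cast h.2
        have h3 : (0 : ℝ) ≤ ((r i : ℕ) : ℝ) ∧ ((r i : ℕ) : ℝ) < (L : ℝ) := by exact_mod_cast hr'
        have hL0 : (0 : ℝ) ≤ (L : ℝ) := Nat.cast_nonneg L
        constructor <;> linarith [h3.1, h3.2]
    _ = ((d : ℝ) + 1) * (2 * (L : ℝ)) := by
        rw [Finset.sum_const, Finset.card_univ, Fintype.card_fin, nsmul_eq_mul]; push_cast; ring

/-- [folklore] **THE FOUR-SITE WEIGHT IS ENVELOPED AT THE SECOND LEG SITE**: for `y` in the near-set of `x′`,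
`|ψ x′ + ψ(x′ + e_{α′}) − ψ(L·y + ρ) − ψ(L·y + ρ + L·e_μ)| ≤ 4·Eψ·e^{2κ₀(d+1)L}·E_{z₀}(x′)`. -/
theorem abs_hessWeight_le (hN : 1 ≤ N) (hκ : 0 ≤ κ₀) (hL : 1 ≤ L) (hr : r ∈ box (d + 1) L) {ψ : (Fin (d + 1) → ℤ) → ℝ} {Eψ : ℝ} (hE : 0 ≤ Eψ)
    {z₀ : Fin (d + 1) → ℤ} (hψ : ∀ x, |ψ x| ≤ Eψ * Real.exp (-(κ₀ * supNorm (quo N x - z₀)))) {x' y : Fin (d + 1) → ℤ}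
    (hy : ∀ i, x' i - 2 * (L : ℤ) < (L : ℤ) * y i ∧ (L : ℤ) * y i ≤ x' i) (α' μ : Fin (d + 1)) :
    |ψ x' + ψ (x' + unitVec α') - ψ ((L : ℤ) • y + toSite r) - ψ ((L : ℤ) • y + toSite r + (L : ℤ) • unitVec μ)|
      ≤ 4 * Eψ * Real.exp (κ₀ * (((d : ℝ) + 1) * (2 * (L : ℝ)))) * Real.exp (-(κ₀ * supNorm (quo N x' - z₀))) := by
  have hL1 : (1 : ℝ) ≤ ((d : ℝ) + 1) * (2 * (L : ℝ)) := by
    have : (1 : ℝ) ≤ L := by exact_mod_cast hL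
    nlinarith [show (0 : ℝ) ≤ d from Nat.cast_nonneg d]
  have hsite : l1 (x' - x') ≤ ((d : ℝ) + 1) * (2 * (L : ℝ)) := by rw [sub_self]; unfold l1; simp; positivity
  have htip : l1 (x' + unitVec α' - x') ≤ ((d : ℝ) + 1) * (2 * (L : ℝ)) := by
    rw [add_sub_cancel_left, ← b6UnitVec_eq, l1_unitVec]; exact hL1
  have hroot : l1 ((L : ℤ) • y + toSite r - x') ≤ ((d : ℝ) + 1) * (2 * (L : ℝ)) := l1_root_sub_le_of_mem hr hy
  have hfar : l1 ((L : ℤ) • y + toSite r + (L : ℤ) • unitVec μ - x') ≤ ((d : ℝ) + 1) * (2 * (L : ℝ)) := l1_farEnd_sub_le_of_mem hr hy μ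
  have h1 := abs_weight_le_of_l1_le hN hκ hE hψ hsite
  have h2 := abs_weight_le_of_l1_le hN hκ hE hψ htip
  have h3 := abs_weight_le_of_l1_le hN hκ hE hψ hroot
  have h4 := abs_weight_le_of_l1_le hN hκ hE hψ hfar
  have t1 := abs_sub (ψ x' + ψ (x' + unitVec α') - ψ ((L : ℤ) • y + toSite r)) (ψ ((L : ℤ) • y + toSite r + (L : ℤ) • unitVec μ))
  have t2 := abs_sub (ψ x' + ψ (x' + unitVec α')) (ψ ((L : ℤ) • y + toSite r))
  have t3 := abs_add_le (ψ x') (ψ (x' + unitVec α'))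
  linarith

/-- [folklore] **THE COEFFICIENT's DECAY READ FROM THE SECOND LEG SITE**: for `y` in the near-set of `x′`, `|c μ y κ u| ≤ C_c·e^{2δ(d+1)L}·e^{−δ|x′ − u|₁}`
(two `ℓ¹` triangle inequalities: `|x′ − u|₁ ≤ |L·y − x′|₁ + |L·y − u|₁`, `|L·y − x′|₁ ≤ (d+1)·2L`). -/
theorem abs_coeff_le_of_mem (hδ : 0 ≤ δ) {c : Fin (d + 1) → (Fin (d + 1) → ℤ) → Fin (d + 1) → (Fin (d + 1) → ℤ) → ℝ} {Cc : ℝ} (hCc : 0 ≤ Cc)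
    (hc : ∀ μ y κ u, |c μ y κ u| ≤ Cc * Real.exp (-δ * l1 ((L : ℤ) • y - u))) {x' y : Fin (d + 1) → ℤ}
    (hy : ∀ i, x' i - 2 * (L : ℤ) < (L : ℤ) * y i ∧ (L : ℤ) * y i ≤ x' i) (μ κ : Fin (d + 1)) (u : Fin (d + 1) → ℤ) :
    |c μ y κ u| ≤ Cc * Real.exp (δ * (((d : ℝ) + 1) * (2 * (L : ℝ)))) * Real.exp (-δ * l1 (x' - u)) := by
  have hprox : l1 ((L : ℤ) • y - x') ≤ ((d : ℝ) + 1) * (2 * (L : ℝ)) := l1_smul_sub_le_of_mem hy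
  have htri : l1 (x' - u) ≤ l1 (x' - (L : ℤ) • y) + l1 ((L : ℤ) • y - u) := l1_sub_triangle _ _ _
  rw [l1_sub_symm x' ((L : ℤ) • y)] at htri
  calc |c μ y κ u| ≤ Cc * Real.exp (-δ * l1 ((L : ℤ) • y - u)) := hc μ y κ u
    _ ≤ Cc * (Real.exp (δ * (((d : ℝ) + 1) * (2 * (L : ℝ)))) * Real.exp (-δ * l1 (x' - u))) := by
        refine mul_le_mul_of_nonneg_left ?_ hCc
        rw [← Real.exp_add, Real.exp_le_exp]
        nlinarith
    _ = _ := by ring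

end Letters

/-! ## §2 The contact kernel of the Λ-piece is a finite coarse sum and is bounded -/

section Kernel

variable {N L : ℕ} {κ₀ δ : ℝ} {r : Fin (d + 1) → ℕ}

/-- [folklore] **THE CONTACT KERNEL OF THE Λ-PIECE IS BOUNDED**: for a box root, ψ under `Eψ·E_{z₀}` (blocking `N`) and a coefficient family under `C_c·e^{−δ|L·y − u|₁}`,
`|−Σ_μ Σ'_y c μ y κ u·((ψ x′ + ψ(x′+e_{α′}) − ψ(L·y+ρ) − ψ(L·y+ρ+L·e_μ))·q¹,ρ_{(μ,y)}(α′,x′)∕2)| ≤ ((d+1)·2^{d+1}·(C_c·e^{2δ(d+1)L})·(4Eψ·e^{2κ₀(d+1)L})·(ℓ∕2))·E_{z₀}(x′)·e^{−δ|x′−u|₁}`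
(the coarse sum runs over the `≤ 2^{d+1}` bonds near `x′`; `|q¹| ≤ ℓ`). -/
theorem abs_lambdaKernel_le (hN : 1 ≤ N) (hκ : 0 ≤ κ₀) (hδ : 0 ≤ δ) (hL : 1 ≤ L) (hr : r ∈ box (d + 1) L)
    {c : Fin (d + 1) → (Fin (d + 1) → ℤ) → Fin (d + 1) → (Fin (d + 1) → ℤ) → ℝ} {Cc : ℝ} (hCc : 0 ≤ Cc)
    (hc : ∀ μ y κ u, |c μ y κ u| ≤ Cc * Real.exp (-δ * l1 ((L : ℤ) • y - u)))
    {ψ : (Fin (d + 1) → ℤ) → ℝ} {Eψ : ℝ} (hE : 0 ≤ Eψ) {z₀ : Fin (d + 1) → ℤ} (hψ : ∀ x, |ψ x| ≤ Eψ * Real.exp (-(κ₀ * supNorm (quo N x - z₀))))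
    (κ : Fin (d + 1)) (u x' : Fin (d + 1) → ℤ) (α' : Fin (d + 1)) :
    |-(∑ μ, ∑' y, c μ y κ u *
        ((ψ x' + ψ (x' + unitVec α') - ψ ((L : ℤ) • y + toSite r) - ψ ((L : ℤ) • y + toSite r + (L : ℤ) • unitVec μ))
          * linKerAt (toSite r) L μ y (α', x') / 2))|
      ≤ (((d : ℝ) + 1) * 2 ^ (d + 1) * (Cc * Real.exp (δ * (((d : ℝ) + 1) * (2 * (L : ℝ))))) *
          (4 * Eψ * Real.exp (κ₀ * (((d : ℝ) + 1) * (2 * (L : ℝ))))) * ((ell (d + 1) L : ℝ) / 2)) *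
        Real.exp (-(κ₀ * supNorm (quo N x' - z₀))) * Real.exp (-δ * l1 (x' - u)) := by
  classical
  obtain ⟨s, hcard, hs, hprox⟩ := exists_finset_near_card (d := d) hL x'
  set B : ℝ := (Cc * Real.exp (δ * (((d : ℝ) + 1) * (2 * (L : ℝ))))) * (4 * Eψ * Real.exp (κ₀ * (((d : ℝ) + 1) * (2 * (L : ℝ))))) *
      ((ell (d + 1) L : ℝ) / 2) * Real.exp (-(κ₀ * supNorm (quo N x' - z₀))) * Real.exp (-δ * l1 (x' - u)) with hB
  have hB0 : 0 ≤ B := by positivity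
  -- each coarse sum is a finite sum over `s`
  have hfin : ∀ μ, ∑' y, c μ y κ u *
        ((ψ x' + ψ (x' + unitVec α') - ψ ((L : ℤ) • y + toSite r) - ψ ((L : ℤ) • y + toSite r + (L : ℤ) • unitVec μ))
          * linKerAt (toSite r) L μ y (α', x') / 2)
      = ∑ y ∈ s, c μ y κ u *
        ((ψ x' + ψ (x' + unitVec α') - ψ ((L : ℤ) • y + toSite r) - ψ ((L : ℤ) • y + toSite r + (L : ℤ) • unitVec μ))
          * linKerAt (toSite r) L μ y (α', x') / 2) := by
    intro μ
    refine tsum_eq_sum fun y hy => ?_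
    have hq : linKerAt (toSite r) L μ y (α', x') = 0 := by
      by_contra hq
      exact hy (hs y (near_of_linKerAt_ne_zero hr hq))
    rw [hq]; ring
  -- uniform bound of each term
  have hterm : ∀ μ, ∀ y ∈ s, |c μ y κ u *
        ((ψ x' + ψ (x' + unitVec α') - ψ ((L : ℤ) • y + toSite r) - ψ ((L : ℤ) • y + toSite r + (L : ℤ) • unitVec μ))
          * linKerAt (toSite r) L μ y (α', x') / 2)| ≤ B := by
    intro μ y hy
    have hyp := hprox y hy
    have h1 := abs_coeff_le_of_mem hδ hCc hc hyp μ κ u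
    have h2 := abs_hessWeight_le hN hκ hL hr hE hψ hyp α' μ
    have h3 : |linKerAt (toSite r) L μ y (α', x')| ≤ (ell (d + 1) L : ℝ) := abs_linKerAt_le hL μ y hr (α', x')
    rw [abs_mul, mul_div_assoc, abs_mul, abs_div, abs_two]
    have h0a : 0 ≤ |c μ y κ u| := abs_nonneg _
    have h0b : 0 ≤ |ψ x' + ψ (x' + unitVec α') - ψ ((L : ℤ) • y + toSite r) - ψ ((L : ℤ) • y + toSite r + (L : ℤ) • unitVec μ)| := abs_nonneg _
    calc |c μ y κ u| * (|ψ x' + ψ (x' + unitVec α') - ψ ((L : ℤ) • y + toSite r) - ψ ((L : ℤ) • y + toSite r + (L : ℤ) • unitVec μ)|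
          * (|linKerAt (toSite r) L μ y (α', x')| / 2))
        ≤ (Cc * Real.exp (δ * (((d : ℝ) + 1) * (2 * (L : ℝ)))) * Real.exp (-δ * l1 (x' - u))) *
          ((4 * Eψ * Real.exp (κ₀ * (((d : ℝ) + 1) * (2 * (L : ℝ)))) * Real.exp (-(κ₀ * supNorm (quo N x' - z₀)))) * ((ell (d + 1) L : ℝ) / 2)) := by
          refine mul_le_mul h1 (mul_le_mul h2 (by linarith) (by positivity) (by positivity)) (by positivity) (by positivity)
      _ = B := by rw [hB]; ring
  rw [abs_neg]
  simp only [hfin]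
  calc |∑ μ, ∑ y ∈ s, c μ y κ u *
        ((ψ x' + ψ (x' + unitVec α') - ψ ((L : ℤ) • y + toSite r) - ψ ((L : ℤ) • y + toSite r + (L : ℤ) • unitVec μ))
          * linKerAt (toSite r) L μ y (α', x') / 2)|
      ≤ ∑ μ, |∑ y ∈ s, c μ y κ u *
        ((ψ x' + ψ (x' + unitVec α') - ψ ((L : ℤ) • y + toSite r) - ψ ((L : ℤ) • y + toSite r + (L : ℤ) • unitVec μ))
          * linKerAt (toSite r) L μ y (α', x') / 2)| := Finset.abs_sum_le_sum_abs _ _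
    _ ≤ ∑ _μ : Fin (d + 1), (2 : ℝ) ^ (d + 1) * B := by
        refine Finset.sum_le_sum fun μ _ => ?_
        calc _ ≤ ∑ y ∈ s, |c μ y κ u *
              ((ψ x' + ψ (x' + unitVec α') - ψ ((L : ℤ) • y + toSite r) - ψ ((L : ℤ) • y + toSite r + (L : ℤ) • unitVec μ))
                * linKerAt (toSite r) L μ y (α', x') / 2)| := Finset.abs_sum_le_sum_abs _ _
          _ ≤ s.card • B := Finset.sum_le_card_nsmul _ _ _ (hterm μ)
          _ ≤ (2 : ℝ) ^ (d + 1) * B := by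
              rw [nsmul_eq_mul]
              exact mul_le_mul_of_nonneg_right (by exact_mod_cast hcard) hB0
    _ = _ := by
        rw [Finset.sum_const, Finset.card_univ, Fintype.card_fin, nsmul_eq_mul, hB]; push_cast; ring

end Kernel

/-! ## §3 The generic Λ-cell bound (second fluctuation leg outer, index leg inner) -/

section Cell

variable {N : ℕ} {κ₀ δ : ℝ}

/-- [folklore] **THE INNER (INDEX-LEG) SUM**: for `|W κ u| ≤ E₁·E_{z₁}(u)` and a kernel `|K κ u α′ x′| ≤ E_K·E_{z₀}(x′)·e^{−δ|x′ − u|₁}` with `0 ≤ κ₀ ≤ δ∕2`,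
`|Σ'_u Σ_κ W κ u · K κ u α′ x′| ≤ (d+1)·Zl(δ∕2)·E₁·E_K·E_{z₁}(x′)·E_{z₀}(x′)` (the wobble `E_{z₁}(u) ≤ e^{κ₀|u−x′|₁}E_{z₁}(x′)` is absorbed by half the rate `δ`). -/
theorem abs_inner_lambda_le (hN : 1 ≤ N) (hκ : 0 ≤ κ₀) (hκδ : κ₀ ≤ δ / 2) (hδ : 0 < δ) {W : Form1 (d + 1) ℝ}
    {K : Fin (d + 1) → (Fin (d + 1) → ℤ) → Fin (d + 1) → (Fin (d + 1) → ℤ) → ℝ} {z₀ z₁ : Fin (d + 1) → ℤ} {E₁ EK : ℝ} (hE₁ : 0 ≤ E₁) (hEK : 0 ≤ EK)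
    (hW : ∀ κ u, |W κ u| ≤ E₁ * Real.exp (-(κ₀ * supNorm (quo N u - z₁))))
    (hK : ∀ κ u α' x', |K κ u α' x'| ≤ EK * Real.exp (-(κ₀ * supNorm (quo N x' - z₀))) * Real.exp (-δ * l1 (x' - u)))
    (α' : Fin (d + 1)) (x' : Fin (d + 1) → ℤ) :
    (Summable fun u => ∑ κ, W κ u * K κ u α' x') ∧
    |∑' u, ∑ κ, W κ u * K κ u α' x'| ≤
      ((d : ℝ) + 1) * Zl (d + 1) (δ / 2) * E₁ * EK * (Real.exp (-(κ₀ * supNorm (quo N x' - z₁))) * Real.exp (-(κ₀ * supNorm (quo N x' - z₀)))) := by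
  have hδ2 : 0 < δ / 2 := by linarith
  set G : (Fin (d + 1) → ℤ) → ℝ := fun u => Real.exp (-(δ / 2) * l1 (x' - u)) with hG
  have hGs : Summable G := summable_exp_shift hδ2 x'
  have hGt : ∑' u, G u = Zl (d + 1) (δ / 2) := tsum_exp_shift x'
  -- pointwise domination
  have hpt : ∀ u, |∑ κ, W κ u * K κ u α' x'| ≤
      ((d : ℝ) + 1) * E₁ * EK * (Real.exp (-(κ₀ * supNorm (quo N x' - z₁))) * Real.exp (-(κ₀ * supNorm (quo N x' - z₀)))) * G u := by
    intro u
    have hwob := env_wobble hN hκ z₁ x' u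
    -- `e^{κ₀|u−x′|₁}·e^{−δ|x′−u|₁} ≤ e^{−(δ/2)|x′−u|₁}`
    have habs : Real.exp (κ₀ * l1 (u - x')) * Real.exp (-δ * l1 (x' - u)) ≤ G u := by
      rw [hG, l1_sub_symm u x', ← Real.exp_add, Real.exp_le_exp]
      have := l1_nonneg (x' - u)
      nlinarith
    calc |∑ κ, W κ u * K κ u α' x'| ≤ ∑ κ, |W κ u * K κ u α' x'| := Finset.abs_sum_le_sum_abs _ _
      _ ≤ ∑ _κ : Fin (d + 1), E₁ * EK * (Real.exp (-(κ₀ * supNorm (quo N x' - z₁))) * Real.exp (-(κ₀ * supNorm (quo N x' - z₀)))) * G u := by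
          refine Finset.sum_le_sum fun κ _ => ?_
          rw [abs_mul]
          calc |W κ u| * |K κ u α' x'|
              ≤ (E₁ * Real.exp (-(κ₀ * supNorm (quo N u - z₁)))) *
                  (EK * Real.exp (-(κ₀ * supNorm (quo N x' - z₀))) * Real.exp (-δ * l1 (x' - u))) :=
                mul_le_mul (hW κ u) (hK κ u α' x') (abs_nonneg _) (by positivity)
            _ ≤ (E₁ * (Real.exp (κ₀ * l1 (u - x')) * Real.exp (-(κ₀ * supNorm (quo N x' - z₁))))) *
                  (EK * Real.exp (-(κ₀ * supNorm (quo N x' - z₀))) * Real.exp (-δ * l1 (x' - u))) := by gcongr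
            _ = E₁ * EK * (Real.exp (-(κ₀ * supNorm (quo N x' - z₁))) * Real.exp (-(κ₀ * supNorm (quo N x' - z₀)))) *
                  (Real.exp (κ₀ * l1 (u - x')) * Real.exp (-δ * l1 (x' - u))) := by ring
            _ ≤ E₁ * EK * (Real.exp (-(κ₀ * supNorm (quo N x' - z₁))) * Real.exp (-(κ₀ * supNorm (quo N x' - z₀)))) * G u :=
                mul_le_mul_of_nonneg_left habs (by positivity)
      _ = _ := by rw [Finset.sum_const, Finset.card_univ, Fintype.card_fin, nsmul_eq_mul]; push_cast; ring
  have hS : Summable fun u => ∑ κ, W κ u * K κ u α' x' :=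
    Summable.of_norm_bounded (hGs.mul_left _) (fun u => by rw [Real.norm_eq_abs]; exact hpt u)
  refine ⟨hS, ?_⟩
  calc |∑' u, ∑ κ, W κ u * K κ u α' x'| ≤ ∑' u, ((d : ℝ) + 1) * E₁ * EK *
        (Real.exp (-(κ₀ * supNorm (quo N x' - z₁))) * Real.exp (-(κ₀ * supNorm (quo N x' - z₀)))) * G u := by
        refine (norm_tsum_le_tsum_norm hS.norm).trans ?_
        simp only [Real.norm_eq_abs]
        exact Summable.tsum_le_tsum hpt hS.abs (hGs.mul_left _)
    _ = _ := by rw [tsum_mul_left, hGt]; ring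

/-- [folklore] **THE GENERIC Λ-CELL BOUND** (second fluctuation leg `R` OUTER, index leg `W` INNER): for `|R α′ x′| ≤ E₃·E_{z₃}(x′)`, `|W κ u| ≤ E₁·E_{z₁}(u)`, a kernel
`|K κ u α′ x′| ≤ E_K·E_{z₀}(x′)·e^{−δ|x′−u|₁}` and rates `0 < κ₀ ≤ δ∕2`:
`|Σ'_{x′} Σ_{α′} R α′ x′ · Σ'_u Σ_κ W κ u · K κ u α′ x′| ≤ (d+1)²·Zl(δ∕2)·E₁E₃E_K·(N^{d+1}·Zl(κ₀∕(4(d+1)))·e^{−(κ₀∕12)(‖z₁−z₀‖∞+‖z₃−z₀‖∞)})`. -/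
theorem abs_cell_lambda_le (hN : 1 ≤ N) (hκ : 0 < κ₀) (hκδ : κ₀ ≤ δ / 2) {R W : Form1 (d + 1) ℝ}
    {K : Fin (d + 1) → (Fin (d + 1) → ℤ) → Fin (d + 1) → (Fin (d + 1) → ℤ) → ℝ} {z₀ z₁ z₃ : Fin (d + 1) → ℤ} {E₁ E₃ EK : ℝ}
    (hE₁ : 0 ≤ E₁) (hE₃ : 0 ≤ E₃) (hEK : 0 ≤ EK)
    (hR : ∀ α' x', |R α' x'| ≤ E₃ * Real.exp (-(κ₀ * supNorm (quo N x' - z₃))))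
    (hW : ∀ κ u, |W κ u| ≤ E₁ * Real.exp (-(κ₀ * supNorm (quo N u - z₁))))
    (hK : ∀ κ u α' x', |K κ u α' x'| ≤ EK * Real.exp (-(κ₀ * supNorm (quo N x' - z₀))) * Real.exp (-δ * l1 (x' - u))) :
    (Summable fun x' => ∑ α', R α' x' * ∑' u, ∑ κ, W κ u * K κ u α' x') ∧
    |∑' x', ∑ α', R α' x' * ∑' u, ∑ κ, W κ u * K κ u α' x'| ≤
      ((d : ℝ) + 1) ^ 2 * Zl (d + 1) (δ / 2) * E₁ * E₃ * EK *
        ((N : ℝ) ^ (d + 1) * Zl (d + 1) (κ₀ / (4 * ((d : ℝ) + 1))) * Real.exp (-(κ₀ / 12) * (supNorm (z₁ - z₀) + supNorm (z₃ - z₀)))) := by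
  have hδ : 0 < δ := by linarith
  set C : ℝ := ((d : ℝ) + 1) * Zl (d + 1) (δ / 2) * E₁ * EK with hC
  have hZ : 0 ≤ Zl (d + 1) (δ / 2) := Zl_nonneg (by linarith)
  have hC0 : 0 ≤ C := by positivity
  have hin : ∀ α' x', |∑' u, ∑ κ, W κ u * K κ u α' x'| ≤
      C * (Real.exp (-(κ₀ * supNorm (quo N x' - z₁))) * Real.exp (-(κ₀ * supNorm (quo N x' - z₀)))) :=
    fun α' x' => (abs_inner_lambda_le hN hκ.le hκδ hδ hE₁ hEK hW hK α' x').2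
  obtain ⟨hPs, hP⟩ := tsum_env3_le (d := d) hN hκ z₀ z₁ z₃
  set P : (Fin (d + 1) → ℤ) → ℝ := fun u => Real.exp (-(κ₀ * supNorm (quo N u - z₀))) * Real.exp (-(κ₀ * supNorm (quo N u - z₁))) *
        Real.exp (-(κ₀ * supNorm (quo N u - z₃))) with hPdef
  have hpt : ∀ x', |∑ α', R α' x' * ∑' u, ∑ κ, W κ u * K κ u α' x'| ≤ ((d : ℝ) + 1) * E₃ * C * P x' := by
    intro x'
    calc |∑ α', R α' x' * ∑' u, ∑ κ, W κ u * K κ u α' x'| ≤ ∑ α', |R α' x' * ∑' u, ∑ κ, W κ u * K κ u α' x'| := Finset.abs_sum_le_sum_abs _ _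
      _ ≤ ∑ _α' : Fin (d + 1), E₃ * C * P x' := by
          refine Finset.sum_le_sum fun α' _ => ?_
          rw [abs_mul]
          calc |R α' x'| * |∑' u, ∑ κ, W κ u * K κ u α' x'|
              ≤ (E₃ * Real.exp (-(κ₀ * supNorm (quo N x' - z₃)))) *
                  (C * (Real.exp (-(κ₀ * supNorm (quo N x' - z₁))) * Real.exp (-(κ₀ * supNorm (quo N x' - z₀))))) :=
                mul_le_mul (hR α' x') (hin α' x') (abs_nonneg _) (by positivity)
            _ = E₃ * C * P x' := by rw [hPdef]; ring
      _ = ((d : ℝ) + 1) * E₃ * C * P x' := by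
          rw [Finset.sum_const, Finset.card_univ, Fintype.card_fin, nsmul_eq_mul]; push_cast; ring
  have hS : Summable fun x' => ∑ α', R α' x' * ∑' u, ∑ κ, W κ u * K κ u α' x' :=
    Summable.of_norm_bounded (hPs.mul_left (((d : ℝ) + 1) * E₃ * C)) (fun x' => by rw [Real.norm_eq_abs]; exact hpt x')
  refine ⟨hS, ?_⟩
  have h1 : |∑' x', ∑ α', R α' x' * ∑' u, ∑ κ, W κ u * K κ u α' x'| ≤ ∑' x', ((d : ℝ) + 1) * E₃ * C * P x' := by
    refine (norm_tsum_le_tsum_norm hS.norm).trans ?_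
    simp only [Real.norm_eq_abs]
    exact Summable.tsum_le_tsum hpt hS.abs (hPs.mul_left _)
  rw [tsum_mul_left] at h1
  have h2 : ((d : ℝ) + 1) * E₃ * C * ∑' x', P x' ≤ ((d : ℝ) + 1) * E₃ * C *
      ((N : ℝ) ^ (d + 1) * Zl (d + 1) (κ₀ / (4 * ((d : ℝ) + 1))) * Real.exp (-(κ₀ / 12) * (supNorm (z₁ - z₀) + supNorm (z₃ - z₀)))) :=
    mul_le_mul_of_nonneg_left hP (by positivity)
  calc |∑' x', ∑ α', R α' x' * ∑' u, ∑ κ, W κ u * K κ u α' x'| ≤ ((d : ℝ) + 1) * E₃ * C * ∑' x', P x' := h1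
    _ ≤ _ := h2
    _ = _ := by rw [hC]; ring

end Cell

/-! ## §4 The Λ cell: identity and bound -/

section LambdaCell

variable {N L : ℕ} {κ₀ δ : ℝ} {r : Fin (d + 1) → ℕ}

/-- [folklore] **THE Λ ONE-GAUGE CELL, IDENTITY** (box root; the gauge leg `dψ` in the first fluctuation slot, the second fluctuation leg `R` OUTER, the index leg `W` INNER):
`Σ'_{x′} Σ_{α′} R α′ x′ · Σ'_u Σ_κ W κ u · (Σ'_x Σ_α (dz ψ) α x · SΛ κ u x x′ (inl α) (inl α′))
  = Σ'_{x′} Σ_{α′} R α′ x′ · Σ'_u Σ_κ W κ u · (−Σ_μ Σ'_y c μ y κ u·((ψ x′ + ψ(x′+e_{α′}) − ψ(L·y+ρ) − ψ(L·y+ρ+L·e_μ))·q¹,ρ_{(μ,y)}(α′,x′)∕2))` (no hypothesis on the legs). -/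
theorem cellLambda_eq (hL : 1 ≤ L) (hr : r ∈ box (d + 1) L) (c : Fin (d + 1) → (Fin (d + 1) → ℤ) → Fin (d + 1) → (Fin (d + 1) → ℤ) → ℝ)
    (R W : Form1 (d + 1) ℝ) (ψ : (Fin (d + 1) → ℤ) → ℝ) :
    ∑' x', ∑ α', R α' x' * ∑' u, ∑ κ, W κ u *
        ∑' x, ∑ α, dz ψ α x * SLam L c (fun μ y => hessFFAt (toSite r) L μ y) κ u x x' (Sum.inl α) (Sum.inl α')
      = ∑' x', ∑ α', R α' x' * ∑' u, ∑ κ, W κ u *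
          -(∑ μ, ∑' y, c μ y κ u *
            ((ψ x' + ψ (x' + unitVec α') - ψ ((L : ℤ) • y + toSite r) - ψ ((L : ℤ) • y + toSite r + (L : ℤ) • unitVec μ))
              * linKerAt (toSite r) L μ y (α', x') / 2)) := by
  haveI : NeZero L := ⟨by omega⟩
  simp only [tsum_dz_mul_SLam_hessFFAt hL hr]

/-- [folklore] **THE Λ ONE-GAUGE CELL, BOUND** («envelopes + coefficient decay in, `L`-constants·`Zl(δ∕2)·N^{d+1}·Zl·e^{−κ′·spread}` out»; rates `0 < κ₀ ≤ δ∕2`):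
`|cellΛ| ≤ (d+1)²·Zl(δ∕2)·E₁E₃·((d+1)·2^{d+1}·(C_c·e^{2δ(d+1)L})·(4Eψ·e^{2κ₀(d+1)L})·(ℓ∕2))·(N^{d+1}·Zl(κ₀∕(4(d+1)))·e^{−(κ₀∕12)(‖z₁−z₀‖∞+‖z₃−z₀‖∞)})`. -/
theorem abs_cellLambda_le (hN : 1 ≤ N) (hκ : 0 < κ₀) (hκδ : κ₀ ≤ δ / 2) (hL : 1 ≤ L) (hr : r ∈ box (d + 1) L)
    {c : Fin (d + 1) → (Fin (d + 1) → ℤ) → Fin (d + 1) → (Fin (d + 1) → ℤ) → ℝ} {Cc : ℝ} (hCc : 0 ≤ Cc)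
    (hc : ∀ μ y κ u, |c μ y κ u| ≤ Cc * Real.exp (-δ * l1 ((L : ℤ) • y - u)))
    {R W : Form1 (d + 1) ℝ} {ψ : (Fin (d + 1) → ℤ) → ℝ} {z₀ z₁ z₃ : Fin (d + 1) → ℤ} {E₁ E₃ Eψ : ℝ} (hE₁ : 0 ≤ E₁) (hE₃ : 0 ≤ E₃) (hEψ : 0 ≤ Eψ)
    (hR : ∀ α' x', |R α' x'| ≤ E₃ * Real.exp (-(κ₀ * supNorm (quo N x' - z₃))))
    (hW : ∀ κ u, |W κ u| ≤ E₁ * Real.exp (-(κ₀ * supNorm (quo N u - z₁))))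
    (hψ : ∀ x, |ψ x| ≤ Eψ * Real.exp (-(κ₀ * supNorm (quo N x - z₀)))) :
    |∑' x', ∑ α', R α' x' * ∑' u, ∑ κ, W κ u *
        ∑' x, ∑ α, dz ψ α x * SLam L c (fun μ y => hessFFAt (toSite r) L μ y) κ u x x' (Sum.inl α) (Sum.inl α')| ≤
      ((d : ℝ) + 1) ^ 2 * Zl (d + 1) (δ / 2) * E₁ * E₃ *
        (((d : ℝ) + 1) * 2 ^ (d + 1) * (Cc * Real.exp (δ * (((d : ℝ) + 1) * (2 * (L : ℝ))))) *
          (4 * Eψ * Real.exp (κ₀ * (((d : ℝ) + 1) * (2 * (L : ℝ))))) * ((ell (d + 1) L : ℝ) / 2)) *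
        ((N : ℝ) ^ (d + 1) * Zl (d + 1) (κ₀ / (4 * ((d : ℝ) + 1))) * Real.exp (-(κ₀ / 12) * (supNorm (z₁ - z₀) + supNorm (z₃ - z₀)))) := by
  have hδ : 0 ≤ δ := by linarith
  rw [cellLambda_eq hL hr]
  exact (abs_cell_lambda_le hN hκ hκδ (K := fun κ u α' x' =>
      -(∑ μ, ∑' y, c μ y κ u *
        ((ψ x' + ψ (x' + unitVec α') - ψ ((L : ℤ) • y + toSite r) - ψ ((L : ℤ) • y + toSite r + (L : ℤ) • unitVec μ))
          * linKerAt (toSite r) L μ y (α', x') / 2)))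
    hE₁ hE₃ (by positivity) hR hW (fun κ u α' x' => abs_lambdaKernel_le hN hκ.le hδ hL hr hCc hc hEψ hψ κ u x' α')).2

end LambdaCell

end Summit.QuantumFields.BalabanUV.Beta.GAN24.ContactOneGaugeCellLambda

end
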